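import Summits.QuantumFields.YangMills.Theorems.PoincareLipschitzSobolevCellTranslationSum
import HarnessLib

/-!
draft FILE F — closed hB
-/

noncomputable section

open MeasureTheory Set Function Filter TopologicalSpace Metric Module
open scoped NNReal ENNReal Topology

namespace Summit.QuantumFields.YangMills.Theorems.PoincareLipschitzSobolevCellTranslationSumClosed

open Literature.Analysis.FunctionSpaces
open Literature.MathematicalPhysics.QuantumFieldTheory.Balaban1983to89
open B4Eq19LatticeOperators (Zd box mem_box unitVec)
open Summit.QuantumFields.YangMills.Theorems.PoincareLipschitzSobolevCellAverages
open Summit.QuantumFields.YangMills.Theorems.PoincareLipschitzSobolevCellTiling (eLpNorm_two_pow_two)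
open Summit.QuantumFields.YangMills.Theorems.PoincareLipschitzSobolevCellTranslationSum
open Summit.QuantumFields.YangMills.Theorems.PoincareLipschitzSamplingCells (isOpen_absCube)
open Summit.QuantumFields.YangMills.Theorems.PoincareLipschitzLatticeToContinuumCellLetters (volume_absCube_lt_top)

/-! ## §1 The density dominates every directional derivative -/

/-- Cauchy–Schwarz in `Fin 3`: `‖T v‖² ≤ ‖v‖² · Σ_i ‖T e_i‖²` for a continuous linear map out of
`ℝ³`. [folklore] -/
theorem norm_apply_sq_le_norm_sq_mul_dens {F : Type*} [NormedAddCommGroup F] [NormedSpace ℝ F]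
    (T : EuclideanSpace ℝ (Fin 3) →L[ℝ] F) (v : EuclideanSpace ℝ (Fin 3)) :
    ‖T v‖ ^ 2 ≤ ‖v‖ ^ 2 * ∑ i : Fin 3, ‖T (EuclideanSpace.single i (1 : ℝ))‖ ^ 2 := by
  have hv : v = ∑ i : Fin 3, v i • EuclideanSpace.single i (1 : ℝ) := by
    have h := (EuclideanSpace.basisFun (Fin 3) ℝ).sum_repr v
    simp only [EuclideanSpace.basisFun_repr, EuclideanSpace.basisFun_apply] at h
    exact h.symm
  have h1 : ‖T v‖ ≤ ∑ i : Fin 3, |v i| * ‖T (EuclideanSpace.single i (1 : ℝ))‖ := by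
    conv_lhs => rw [hv]
    rw [map_sum]
    refine (norm_sum_le _ _).trans (Finset.sum_le_sum fun i _ => ?_)
    rw [map_smul, norm_smul, Real.norm_eq_abs]
  have h2 : (∑ i : Fin 3, |v i| * ‖T (EuclideanSpace.single i (1 : ℝ))‖) ^ 2 ≤
      (∑ i : Fin 3, |v i| ^ 2) * ∑ i : Fin 3, ‖T (EuclideanSpace.single i (1 : ℝ))‖ ^ 2 :=
    Finset.sum_mul_sq_le_sq_mul_sq _ _ _
  have h3 : ∑ i : Fin 3, |v i| ^ 2 = ‖v‖ ^ 2 := by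
    rw [EuclideanSpace.norm_eq, Real.sq_sqrt (Finset.sum_nonneg fun i _ => by positivity)]
    exact Finset.sum_congr rfl fun i _ => by rw [Real.norm_eq_abs]
  calc ‖T v‖ ^ 2 ≤ (∑ i : Fin 3, |v i| * ‖T (EuclideanSpace.single i (1 : ℝ))‖) ^ 2 := by
        gcongr
    _ ≤ _ := h2
    _ = _ := by rw [h3]

/-- From `IntegrableOn dens Q` (the Dirichlet density of the weak derivative) every directional
derivative `x ↦ GV x v` is square-integrable on `Q`. [folklore] -/
theorem memLp_two_apply_of_integrableOn_dens {Q : Set (EuclideanSpace ℝ (Fin 3))} (hQ : IsOpen Q)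
    {V : EuclideanSpace ℝ (Fin 3) → EuclideanSpace ℝ (Fin 4)}
    {GV : EuclideanSpace ℝ (Fin 3) → EuclideanSpace ℝ (Fin 3) →L[ℝ] EuclideanSpace ℝ (Fin 4)}
    (hGV : HasWeakFDerivOn (⟨Q, hQ⟩ : Opens _) volume V GV)
    (hdens : IntegrableOn (fun x => ∑ i : Fin 3, ‖GV x (EuclideanSpace.single i (1 : ℝ))‖ ^ 2) Q volume)
    (v : EuclideanSpace ℝ (Fin 3)) :
    MemLp (fun x => GV x v) 2 (volume.restrict Q) := by
  have hGm : AEStronglyMeasurable GV (volume.restrict Q) :=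
    hGV.locallyIntegrableOn_deriv.aestronglyMeasurable
  have hm : AEStronglyMeasurable (fun x => GV x v) (volume.restrict Q) :=
    (ContinuousLinearMap.apply ℝ (EuclideanSpace ℝ (Fin 4)) v).continuous.comp_aestronglyMeasurable hGm
  rw [memLp_two_iff_integrable_sq_norm hm]
  refine (hdens.const_mul (‖v‖ ^ 2)).mono' (hm.norm.pow 2) (Eventually.of_forall fun x => ?_)
  rw [Real.norm_eq_abs, abs_of_nonneg (by positivity)]
  exact norm_apply_sq_le_norm_sq_mul_dens (GV x) v

/-! ## §2 Bookkeeping: `ℝ≥0∞` rows read as real rows -/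

/-- A finite sum of squared `ℝ≥0∞`-norms is `ofReal` of the real sum. [folklore] -/
theorem sum_enorm_sq_eq_ofReal {ι : Type*} (s : Finset ι) (f : ι → EuclideanSpace ℝ (Fin 4)) :
    ∑ i ∈ s, ‖f i‖ₑ ^ 2 = ENNReal.ofReal (∑ i ∈ s, ‖f i‖ ^ 2) := by
  rw [ENNReal.ofReal_sum_of_nonneg (fun i _ => by positivity)]
  refine Finset.sum_congr rfl fun i _ => ?_
  rw [← ofReal_norm, ← ENNReal.ofReal_pow (norm_nonneg _)]

/-- For `f ∈ L²(μ)`: `(eLpNorm f 2 μ)² = ofReal (∫ ‖f‖²)`. [folklore] -/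
theorem eLpNorm_two_pow_two_eq_ofReal_integral {X : Type*} [MeasurableSpace X] {ν : Measure X}
    {G : Type*} [NormedAddCommGroup G] {f : X → G} (hf : MemLp f 2 ν) :
    eLpNorm f 2 ν ^ 2 = ENNReal.ofReal (∫ x, ‖f x‖ ^ 2 ∂ν) := by
  have hint : Integrable (fun x => ‖f x‖ ^ 2) ν :=
    (memLp_two_iff_integrable_sq_norm hf.1).1 hf
  have hpt : ∀ x, ‖f x‖ₑ ^ 2 = ENNReal.ofReal (‖f x‖ ^ 2) := fun x => by
    rw [← ofReal_norm, ← ENNReal.ofReal_pow (norm_nonneg _)]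
  rw [eLpNorm_two_pow_two]
  simp_rw [hpt]
  rw [← ofReal_integral_eq_lintegral_ofReal hint (Eventually.of_forall fun x => by positivity)]

/-! ## §3 The closed row hB -/

/-- ★★★ **hB CLOSED — THE SUMMED SHARP TRANSLATION ROW IN THE KNIT'S LETTERS** (px5 g8's (Γ5-KNIT)
displayed hypothesis hB v2, VERBATIM — text `KNIT-hB.v2.text.px5g8.txt` sha16 b845a63c7aa57e95, the
`L^∞` row `‖V x‖ ≤ 1` on `Q` being px5's (α) of 13:17:06Z): for `V` with
weak derivative `GV` on the open unit cube `Q`, `‖V‖ ≤ 1` on `Q`, integrable Dirichlet density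
`dens = Σ_i ‖GV·e_i‖²`, every `s′ < 1`, `R ≥ 1`, `n` with `(n+2)∕R ≤ s′`, and the cell averages
`a y = R³•∫_{cell_y} V`:
`R⁻¹ · Σ_{y ∈ box 0 n} Σ_μ ‖a(y+e_μ) − a y‖² ≤ ∫_{Q_{s′}} dens`.
From FILE E ★★★`sum_enorm_sub_cellAverage_sq_le` (per `μ`, `ℝ≥0∞`), FILE B's `W^{1,2}` packaging,
§1 and §2. [cite: Evans2010, §5.8.2 Theorem 3 (i)] -/
theorem hB_holds :
    ∀ (hQ : IsOpen {x : EuclideanSpace ℝ (Fin 3) | ∀ i : Fin 3, |x i| < 1})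
      (V : EuclideanSpace ℝ (Fin 3) → EuclideanSpace ℝ (Fin 4))
      (GV : EuclideanSpace ℝ (Fin 3) → (EuclideanSpace ℝ (Fin 3) →L[ℝ] EuclideanSpace ℝ (Fin 4))),
      HasWeakFDerivOn ⟨{x : EuclideanSpace ℝ (Fin 3) | ∀ i : Fin 3, |x i| < 1}, hQ⟩ volume V GV →
      IntegrableOn (fun x => ∑ i : Fin 3, ‖GV x (EuclideanSpace.single i (1:ℝ))‖ ^ 2)
        {x : EuclideanSpace ℝ (Fin 3) | ∀ i : Fin 3, |x i| < 1} volume →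
      (∀ x : EuclideanSpace ℝ (Fin 3), (∀ i : Fin 3, |x i| < 1) → ‖V x‖ ≤ 1) →
      ∀ (s' : ℝ), s' < 1 → ∀ (R : ℕ) (n : ℤ), 0 < R → ((n : ℝ) + 2) / R ≤ s' →
      ∀ (a : Zd 3 → EuclideanSpace ℝ (Fin 4)),
        (∀ y, a y = ((R : ℝ) ^ 3) • ∫ x in {x : EuclideanSpace ℝ (Fin 3) |
            ∀ i, (y i : ℝ) / R < x i ∧ x i < ((y i : ℝ) + 1) / R}, V x) →
        (R : ℝ)⁻¹ * ∑ y ∈ box (0 : Zd 3) n, ∑ μ : Fin 3, ‖a (y + unitVec μ) - a y‖ ^ 2 ≤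
          ∫ x in {x : EuclideanSpace ℝ (Fin 3) | ∀ i : Fin 3, |x i| < s'},
            ∑ i : Fin 3, ‖GV x (EuclideanSpace.single i (1:ℝ))‖ ^ 2 := by
  intro hQ V GV hGV hdens hV1 s' hs' R n hR hns a ha
  have hR0 : (0 : ℝ) < R := by exact_mod_cast hR
  set Q : Set (EuclideanSpace ℝ (Fin 3)) := {x | ∀ i : Fin 3, |x i| < 1} with hQdef
  set Q' : Set (EuclideanSpace ℝ (Fin 3)) := {x | ∀ i : Fin 3, |x i| < s'} with hQ'def
  -- the integrand on the right is nonnegative and integrable on `Q' ⊆ Q`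
  have hQ'Q : Q' ⊆ Q := fun x hx i => (hx i).trans hs'
  have hdens' : IntegrableOn (fun x => ∑ i : Fin 3, ‖GV x (EuclideanSpace.single i (1:ℝ))‖ ^ 2) Q' volume :=
    hdens.mono_set hQ'Q
  have hRHS : 0 ≤ ∫ x in Q', ∑ i : Fin 3, ‖GV x (EuclideanSpace.single i (1:ℝ))‖ ^ 2 :=
    integral_nonneg fun x => Finset.sum_nonneg fun i _ => by positivity
  -- negative `n`: the box is empty
  rcases lt_or_ge n 0 with hn | hn
  · have hbox : box (0 : Zd 3) n = ∅ := by
      ext y; simp only [Finset.notMem_empty, iff_false]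
      intro hy
      have := (mem_box.mp hy) 0
      have h0 : (0 : ℤ) ≤ |y 0 - (0 : Zd 3) 0| := abs_nonneg _
      linarith
    rw [hbox, Finset.sum_empty, mul_zero]
    exact hRHS
  -- `n = m : ℕ`
  obtain ⟨m, rfl⟩ := Int.eq_ofNat_of_zero_le hn
  have hms : ((m : ℝ) + 2) / R ≤ s' := by
    have h := hns; push_cast at h; exact h
  -- Sobolev data on `Q'`
  have hle : (⟨Q', isOpen_absCube s'⟩ : Opens (EuclideanSpace ℝ (Fin 3))) ≤ (⟨Q, hQ⟩ : Opens _) := hQ'Q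
  have hfin : volume Q' ≠ ∞ := (volume_absCube_lt_top s').ne
  have hVM : ∀ᵐ x ∂(volume.restrict Q), ‖V x‖ ≤ 1 :=
    (ae_restrict_iff' hQ.measurableSet).2 (Eventually.of_forall fun x hx => hV1 x hx)
  have hGV2 : ∀ v, MemLp (fun x => GV x v) 2 (volume.restrict Q) :=
    fun v => memLp_two_apply_of_integrableOn_dens hQ hGV hdens v
  have hV' : MemSobolevDomain 1 2 (⟨Q', isOpen_absCube s'⟩ : Opens _) volume V :=
    memSobolevDomain_one_two_of_bound hGV hle hfin hVM hGV2
  have hGV' : HasWeakFDerivOn (⟨Q', isOpen_absCube s'⟩ : Opens _) volume V GV :=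
    hasWeakFDerivOn_mono hGV hle
  -- the per-direction rows, read in `ℝ`
  have hrow : ∀ μ : Fin 3, ∑ y ∈ box (0 : Zd 3) (m : ℤ), ‖a (y + unitVec μ) - a y‖ ^ 2 ≤
      R * ∫ x in Q', ‖GV x (EuclideanSpace.single μ (1:ℝ))‖ ^ 2 := by
    intro μ
    have h := sum_enorm_sub_cellAverage_sq_le hR m hms μ V GV hV' hGV' a ha
    have hmem : MemLp (fun x => GV x (EuclideanSpace.single μ (1:ℝ))) 2 (volume.restrict Q') :=
      (hGV2 _).mono_measure (Measure.restrict_mono hQ'Q le_rfl)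
    rw [sum_enorm_sq_eq_ofReal, eLpNorm_two_pow_two_eq_ofReal_integral hmem,
      ← ENNReal.ofReal_mul hR0.le] at h
    have hI : 0 ≤ ∫ x in Q', ‖GV x (EuclideanSpace.single μ (1:ℝ))‖ ^ 2 :=
      integral_nonneg fun x => by positivity
    exact (ENNReal.ofReal_le_ofReal_iff (by positivity)).1 h
  -- sum over the directions and divide by `R`
  have hint : ∀ μ : Fin 3, IntegrableOn (fun x => ‖GV x (EuclideanSpace.single μ (1:ℝ))‖ ^ 2) Q' volume := by
    intro μ
    have hmem : MemLp (fun x => GV x (EuclideanSpace.single μ (1:ℝ))) 2 (volume.restrict Q') :=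
      (hGV2 _).mono_measure (Measure.restrict_mono hQ'Q le_rfl)
    exact (memLp_two_iff_integrable_sq_norm hmem.1).1 hmem
  have hsum : ∑ μ : Fin 3, ∫ x in Q', ‖GV x (EuclideanSpace.single μ (1:ℝ))‖ ^ 2 =
      ∫ x in Q', ∑ i : Fin 3, ‖GV x (EuclideanSpace.single i (1:ℝ))‖ ^ 2 :=
    (integral_finsetSum _ fun μ _ => hint μ).symm
  rw [Finset.sum_comm, ← hsum]
  have htot : ∑ μ : Fin 3, ∑ y ∈ box (0 : Zd 3) (m : ℤ), ‖a (y + unitVec μ) - a y‖ ^ 2 ≤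
      R * ∑ μ : Fin 3, ∫ x in Q', ‖GV x (EuclideanSpace.single μ (1:ℝ))‖ ^ 2 := by
    rw [Finset.mul_sum]; exact Finset.sum_le_sum fun μ _ => hrow μ
  rw [inv_mul_le_iff₀ hR0]
  exact htot

end Summit.QuantumFields.YangMills.Theorems.PoincareLipschitzSobolevCellTranslationSumClosed

end
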